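import Summits.Ventures.PercRepro.Night2FatZDegen
import Summits.Ventures.PercRepro.Night2FatDegDichotomy

/-!
# night-2: the SINGLY DEGENERATE two-planes regime — the loads through a side point

Regime data as in `Night2FatZDegen`: `H₀ = π₂ ∪ π₃` for the planes `π_i = clF (insert c_i R₁)` through the spine
`L = clF R₁ ∩ H₀`, the points `A` of `π₂` off the spine of rank `≥ 3` (`hnd₂`) and the points `M` of `π₃` off the
spine COLLINEAR (`hdeg₃ : rk M ≤ 2`, used only by the counts).  Call the points of `M` the SIDE points.
* **`subset_clF_side_of_mem_side`**: a line of `π₃` through a side point lies in `clF M` (it has two points off the spine;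
  no degeneracy needed — in the degenerate regime `clF M` is the LINE of `M`).
* **`not_mem_side_of_dist_two_line_deg`**: a distance-2 line contains no side point (`rkN_off_le_two_of_line_of_source_planes`
  against `hnd₂`).
* **`loaded_target_side_dichotomy_deg`**: a loaded target `T ∋ x` above a lossy basis pair whose `Y = (T ∖ Q) ∖ {x}`
  contains a side point `y₃` is either a distance-2 load whose line is a CLASS BASIS LINE `clF {a, b}` coplanar with
  `M` containing `Y ∖ {y₃}` (and `y₃` is the only side point of `Y`), or a distance-1 load along the line of `M`
  (`Y ⊆ clF M`, two basis points on that line, `M ∪ {w₀, x}` of rank `≥ 4`).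
* **`dload_eq_zero_of_side_free_deg`**: a target through a side point and a point `f` off `clF M` lying on no class
  basis line coplanar with `M` is unloaded; **`dload_eq_zero_of_two_side_points_deg`**: a target through two side points
  and a point off `clF M` is unloaded; **`dload_eq_zero_of_singleton_of_class`**: the level-2 target of a point on no
  non-class basis line is unloaded.
Paper `proofs/NIGHT-2-g35.md` §1.
-/

namespace PercRepro.Shadow

open PercRepro.ThmH PercRepro.PerFlat

variable {α : Type*} [DecidableEq α] {M : Matroid α} [M.Finite] {G : Finset α}

/-- **A line of `π₃` through a side point lies in `clF M`** when the side points are collinear. -/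
theorem subset_clF_side_of_mem_side (hs : ∀ e ∈ gr M, ∀ f ∈ gr M, e ≠ f → rkN M {e, f} = 2)
    {V : Finset α} (hVg : V ⊆ gr M) {R₁ : Finset α} {c₃ : α} {R : Finset α} (hRV : R ⊆ V) (hR2 : rkN M R = 2) (hR3 : 3 ≤ R.card) (hRπ : R ⊆ clF M (insert c₃ R₁))
    {y₃ : α} (hy₃R : y₃ ∈ R) (hy₃L : y₃ ∉ clF M R₁) :
    R ⊆ clF M (V.filter (fun e => e ∈ clF M (insert c₃ R₁) ∧ e ∉ clF M R₁)) := by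
  have hRg : R ⊆ gr M := hRV.trans hVg
  set Mset := V.filter (fun e => e ∈ clF M (insert c₃ R₁) ∧ e ∉ clF M R₁) with hMset
  have hMg : Mset ⊆ gr M := (Finset.filter_subset _ _).trans hVg
  -- at most one point of `R` on the spine
  have hL1 : (R.filter (fun e => e ∈ clF M R₁)).card ≤ 1 := by
    rw [Finset.card_le_one]
    intro a ha b hb
    by_contra hab
    rw [Finset.mem_filter] at ha hb
    have := subset_clF_of_rkN_le_two_of_two_mem hs hRg hR2.le ha.1 hb.1 hab ha.2 hb.2 hy₃R
    exact hy₃L this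
  have hsplit := Finset.card_filter_add_card_filter_not (s := R) (fun e => e ∈ clF M R₁)
  have h2 : 1 < (R.filter (fun e => ¬ e ∈ clF M R₁)).card := by omega
  obtain ⟨a, ha, b, hb, hab⟩ := Finset.one_lt_card.1 h2
  rw [Finset.mem_filter] at ha hb
  have haM : a ∈ Mset := Finset.mem_filter.2 ⟨hRV ha.1, hRπ ha.1, ha.2⟩
  have hbM : b ∈ Mset := Finset.mem_filter.2 ⟨hRV hb.1, hRπ hb.1, hb.2⟩
  exact subset_clF_of_rkN_le_two_of_two_mem hs hRg hR2.le ha.1 hb.1 hab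
    (subset_clF_of_subset_gr hMg haM) (subset_clF_of_subset_gr hMg hbM)

/-- **A distance-2 line contains no side point** when the points of `π₂` off the spine have rank `≥ 3`. -/
theorem not_mem_side_of_dist_two_line_deg (hs : ∀ e ∈ gr M, ∀ f ∈ gr M, e ≠ f → rkN M {e, f} = 2)
    {V : Finset α} (hVg : V ⊆ gr M) {R₁ : Finset α} (hR₁V : R₁ ⊆ V) (hR₁2 : rkN M R₁ = 2) (hR₁3 : 3 ≤ R₁.card)
    {c₂ c₃ : α} (hc₂V : c₂ ∈ V) (hc₃V : c₃ ∈ V) (hc₂ : c₂ ∉ clF M R₁) (hc₃ : c₃ ∉ clF M (insert c₂ R₁))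
    (hcover : ∀ e ∈ V, e ∈ clF M (insert c₂ R₁) ∨ e ∈ clF M (insert c₃ R₁))
    (hnd₂ : 3 ≤ rkN M (V.filter (fun e => e ∈ clF M (insert c₂ R₁) ∧ e ∉ clF M R₁)))
    {R : Finset α} (hRV : R ⊆ V) (hR2 : rkN M R = 2) (hR3 : 3 ≤ R.card) {c₂' c₃' : α}
    (hc₂'g : c₂' ∈ gr M) (hc₃'g : c₃' ∈ gr M) (hc₂' : c₂' ∉ clF M R) (hc₃' : c₃' ∉ clF M (insert c₂' R))
    (hcover' : ∀ e ∈ V, e ∈ clF M (insert c₂' R) ∨ e ∈ clF M (insert c₃' R))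
    {y₃ : α} (hy₃R : y₃ ∈ R) (hy₃3 : y₃ ∈ clF M (insert c₃ R₁)) (hy₃L : y₃ ∉ clF M R₁) : False := by
  have hR₁g : R₁ ⊆ gr M := hR₁V.trans hVg
  have hc₂g : c₂ ∈ gr M := hVg hc₂V
  have hc₃g : c₃ ∈ gr M := hVg hc₃V
  have hRg : R ⊆ gr M := hRV.trans hVg
  have hRcover : ∀ e ∈ R, e ∈ clF M (insert c₂ R₁) ∨ e ∈ clF M (insert c₃ R₁) := fun e he => hcover e (hRV he)
  have hRπ : R ⊆ clF M (insert c₃ R₁) := by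
    rcases subset_plane_of_rkN_le_two_of_cover hs hRg hR2.le hR3 hRcover with h' | h'
    · exact absurd (mem_clF_of_mem_two_planes hR₁g hc₂g hc₃g hc₂ hc₃ (h' hy₃R) hy₃3) hy₃L
    · exact h'
  have hS₂ : ∀ e ∈ V.filter (fun e => e ∈ clF M (insert c₂ R₁) ∧ e ∉ clF M R₁),
      e ∈ clF M (insert c₂ R₁) ∧ e ∉ clF M R₁ := fun e he => (Finset.mem_filter.1 he).2
  have := rkN_off_le_two_of_line_of_source_planes hs hR₁g hR₁2 hR₁3 hc₂g hc₃g hc₂ hc₃ hRg hR2 hRπ hy₃R hy₃L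
    hc₂'g hc₃'g hc₂' hc₃' hS₂ (fun e he => hcover' e (Finset.mem_filter.1 he).1) (fun e he => hcover' e (hR₁V he))
  omega

/-- **The loads through a side point** (singly degenerate regime): a loaded target `T ∋ x` above a lossy basis pair
whose `Y` contains a side point `y₃` is a distance-2 load on a class basis line `clF {a, b}` coplanar with `M`
containing `Y ∖ {y₃}` (with no other side point in `Y`), or a distance-1 load along the line of `M`. -/
theorem loaded_target_side_dichotomy_deg (hG : G ∈ flatsQ M (5 + 1)) (hd : (gr M \ G).card = 2)
    (hk : kColoops M G = 1) (hs : ∀ e ∈ gr M, ∀ f ∈ gr M, e ≠ f → rkN M {e, f} = 2)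
    (hl : ∀ e ∈ gr M, M.Indep {e}) (hfat : (fatClosures M 5 G 2).card ≤ 1) {B₀ : Finset α}
    (hB₀ : B₀ ∈ thinMembers M 5 G) {w₀ x : α} (hD : G \ clF M B₀ = {w₀, x}) (hne : w₀ ≠ x) {R₁ : Finset α}
    (hR₁V : R₁ ⊆ (G \ coloops M G) \ {w₀, x}) (hR₁2 : rkN M R₁ = 2) (hR₁3 : 3 ≤ R₁.card) {c₂ c₃ : α}
    (hc₂V : c₂ ∈ (G \ coloops M G) \ {w₀, x}) (hc₃V : c₃ ∈ (G \ coloops M G) \ {w₀, x})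
    (hc₂ : c₂ ∉ clF M R₁) (hc₃ : c₃ ∉ clF M (insert c₂ R₁))
    (hcover : ∀ e ∈ (G \ coloops M G) \ {w₀, x}, e ∈ clF M (insert c₂ R₁) ∨ e ∈ clF M (insert c₃ R₁))
    (hnd₂ : 3 ≤ rkN M (((G \ coloops M G) \ {w₀, x}).filter
      (fun e => e ∈ clF M (insert c₂ R₁) ∧ e ∉ clF M R₁)))
    {B : Finset α} (hB : B ∈ thinMembers M 5 G) (hnP : ¬ bigP M G B) {z : α} (hz : z ∈ G \ clF M B)
    (hw₀ : w₀ ∈ insert z B) (hxQ : x ∉ insert z B) {T : Finset α} (hT : T ∈ tgtSets M 5 G B z) (hxT : x ∈ T)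
    {y₃ : α} (hy₃ : y₃ ∈ (T \ insert z B).erase x) (hy₃3 : y₃ ∈ clF M (insert c₃ R₁)) (hy₃L : y₃ ∉ clF M R₁)
    (hload : dload M 5 G (bigP M G) (dshGT2 M 5 G) T ≠ 0) :
    (∃ a ∈ (insert z B \ coloops M G).erase w₀, ∃ b ∈ (insert z B \ coloops M G).erase w₀, a ≠ b ∧
        rkN M (insert w₀ (insert x {a, b})) ≤ 3 ∧
        rkN M ({a, b} ∪ ((G \ coloops M G) \ {w₀, x}).filter
          (fun e => e ∈ clF M (insert c₃ R₁) ∧ e ∉ clF M R₁)) ≤ 3 ∧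
        ((T \ insert z B).erase x).erase y₃ ⊆ clF M {a, b} ∧
        ∀ e ∈ ((T \ insert z B).erase x).erase y₃, ¬ (e ∈ clF M (insert c₃ R₁) ∧ e ∉ clF M R₁)) ∨
      ((T \ insert z B).erase x ⊆ clF M (((G \ coloops M G) \ {w₀, x}).filter
          (fun e => e ∈ clF M (insert c₃ R₁) ∧ e ∉ clF M R₁)) ∧
        4 ≤ rkN M (insert w₀ (insert x (((G \ coloops M G) \ {w₀, x}).filter
          (fun e => e ∈ clF M (insert c₃ R₁) ∧ e ∉ clF M R₁)))) ∧
        (∃ a ∈ (insert z B \ coloops M G).erase w₀, ∃ b ∈ (insert z B \ coloops M G).erase w₀, a ≠ b ∧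
          a ∈ clF M (((G \ coloops M G) \ {w₀, x}).filter
            (fun e => e ∈ clF M (insert c₃ R₁) ∧ e ∉ clF M R₁)) ∧
          b ∈ clF M (((G \ coloops M G) \ {w₀, x}).filter
            (fun e => e ∈ clF M (insert c₃ R₁) ∧ e ∉ clF M R₁))) ∧
        3 ≤ rkN M (G \ T)) := by
  have hGg : G ⊆ gr M := (mem_flatsQ.1 hG).1
  have hd' : (gr M \ G).card ≤ 5 := by omega
  have hTG : T ⊆ G := subset_G_of_mem_shadowAt (mem_tgtSets.1 hT).1
  have hQT : insert z B ⊆ T := (mem_tgtSets.1 hT).2.1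
  have hw₀T : w₀ ∈ T := hQT hw₀
  set V := (G \ coloops M G) \ {w₀, x} with hV
  have hVg : V ⊆ gr M := fun e he => hGg (Finset.mem_sdiff.1 (Finset.mem_sdiff.1 he).1).1
  set Mset := V.filter (fun e => e ∈ clF M (insert c₃ R₁) ∧ e ∉ clF M R₁) with hMset
  have hMg : Mset ⊆ gr M := (Finset.filter_subset _ _).trans hVg
  have hR₁g : R₁ ⊆ gr M := hR₁V.trans hVg
  have hc₂g : c₂ ∈ gr M := hVg hc₂V
  have hc₃g : c₃ ∈ gr M := hVg hc₃V
  have hy₃x : y₃ ≠ x := (Finset.mem_erase.1 hy₃).1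
  have hy₃TQ : y₃ ∈ T \ insert z B := Finset.mem_of_mem_erase hy₃
  have hy₃G : y₃ ∈ G := hTG (Finset.mem_sdiff.1 hy₃TQ).1
  have hy₃Q : y₃ ∉ insert z B := (Finset.mem_sdiff.1 hy₃TQ).2
  have hKQ : coloops M G ⊆ insert z B :=
    (coloops_subset_of_mem_thinMembers hG hd' hB).trans (Finset.subset_insert _ _)
  have hy₃V : y₃ ∈ V := by
    rw [hV, Finset.mem_sdiff, Finset.mem_sdiff, Finset.mem_insert, Finset.mem_singleton]
    refine ⟨⟨hy₃G, fun h => hy₃Q (hKQ h)⟩, ?_⟩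
    rintro (rfl | rfl)
    · exact hy₃Q hw₀
    · exact hy₃x rfl
  have hy₃M : y₃ ∈ Mset := Finset.mem_filter.2 ⟨hy₃V, hy₃3, hy₃L⟩
  -- a point of `R ⊆ (T ∖ K) ∖ {w₀, x}` lying in `Q` is a basis point
  have hRP₀ : ∀ R : Finset α, R ⊆ (T \ coloops M G) \ {w₀, x} → ∀ r ∈ R, r ∈ insert z B →
      r ∈ (insert z B \ coloops M G).erase w₀ := by
    intro R hR r hr hrQ
    have h1 := Finset.mem_sdiff.1 (hR hr)
    rw [Finset.mem_insert, Finset.mem_singleton, not_or] at h1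
    exact Finset.mem_erase.2 ⟨h1.2.1, Finset.mem_sdiff.2 ⟨hrQ, (Finset.mem_sdiff.1 h1.1).2⟩⟩
  have hTV : ∀ R : Finset α, R ⊆ (T \ coloops M G) \ {w₀, x} → R ⊆ V := fun R hR r hr =>
    Finset.sdiff_subset_sdiff (Finset.sdiff_subset_sdiff hTG (Finset.Subset.refl _)) (Finset.Subset.refl _) (hR hr)
  obtain ⟨R, hR, hR2, hR3, hcase⟩ :=
    loaded_fat_target_dichotomy_full hG hd hk hs hl hfat hB₀ hD hne hTG hw₀T hxT hload
  have hRV : R ⊆ V := hTV R hR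
  have hRg : R ⊆ gr M := hRV.trans hVg
  have hRcover : ∀ e ∈ R, e ∈ clF M (insert c₂ R₁) ∨ e ∈ clF M (insert c₃ R₁) := fun e he => hcover e (hRV he)
  rcases hcase with ⟨hRc, hGT, hRncls⟩ | ⟨hRc, hRcls, c₂', hc₂'T, c₃', hc₃'T, hc₂', hc₃', hcover'⟩
  · -- distance one along the line of `M`
    right
    obtain ⟨hYR, hRQ2⟩ := sdiff_subset_line_of_dist_one_fat hG hd hk hB hnP hz hT hxT hxQ hR hR2 hRc
    have hy₃R : y₃ ∈ R := hYR hy₃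
    have hRπ : R ⊆ clF M (insert c₃ R₁) := by
      rcases subset_plane_of_rkN_le_two_of_cover hs hRg hR2.le hR3 hRcover with h' | h'
      · exact absurd (mem_clF_of_mem_two_planes hR₁g hc₂g hc₃g hc₂ hc₃ (h' hy₃R) hy₃3) hy₃L
      · exact h'
    have hRM : R ⊆ clF M Mset := subset_clF_side_of_mem_side hs hVg hRV hR2 hR3 hRπ hy₃R hy₃L
    refine ⟨hYR.trans hRM, ?_, ?_, hGT⟩
    · -- the line of `M` is not a class line
      have hsub : insert w₀ (insert x R) ⊆ clF M (insert w₀ (insert x Mset)) := by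
        have hMg' : insert w₀ (insert x Mset) ⊆ gr M := by
          refine Finset.insert_subset ?_ (Finset.insert_subset ?_ hMg)
          · have : w₀ ∈ G \ clF M B₀ := by rw [hD]; exact Finset.mem_insert_self _ _
            exact hGg (Finset.mem_sdiff.1 this).1
          · have : x ∈ G \ clF M B₀ := by rw [hD]; exact Finset.mem_insert_of_mem (Finset.mem_singleton_self _)
            exact hGg (Finset.mem_sdiff.1 this).1
        intro e he
        rw [Finset.mem_insert, Finset.mem_insert] at he
        rcases he with rfl | rfl | he
        · exact subset_clF_of_subset_gr hMg' (Finset.mem_insert_self _ _)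
        · exact subset_clF_of_subset_gr hMg' (Finset.mem_insert_of_mem (Finset.mem_insert_self _ _))
        · exact clF_mono ((Finset.subset_insert _ _).trans (Finset.subset_insert _ _)) (hRM he)
      have := rkN_mono (M := M) hsub
      rw [rkN_clF] at this
      omega
    · obtain ⟨a, ha, b, hb, hab⟩ := Finset.one_lt_card.1 (by omega : 1 < (R ∩ insert z B).card)
      exact ⟨a, hRP₀ R hR a (Finset.mem_inter.1 ha).1 (Finset.mem_inter.1 ha).2,
        b, hRP₀ R hR b (Finset.mem_inter.1 hb).1 (Finset.mem_inter.1 hb).2, hab,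
        hRM (Finset.mem_inter.1 ha).1, hRM (Finset.mem_inter.1 hb).1⟩
  · -- distance two: the source's planes
    left
    set R' := R with hR'def
    have hR' : R' ⊆ (T \ coloops M G) \ {w₀, x} := hR
    have hR'2 : rkN M R' = 2 := hR2
    have hR'3 : 3 ≤ R'.card := hR3
    have hR'c : R'.card + 5 = (T \ coloops M G).card := hRc
    have hR'cls : rkN M (insert w₀ (insert x R')) ≤ 3 := hRcls
    have hR'V : R' ⊆ V := hRV
    have hR'g : R' ⊆ gr M := hRg
    have hR'cover : ∀ e ∈ R', e ∈ clF M (insert c₂ R₁) ∨ e ∈ clF M (insert c₃ R₁) := hRcover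
    have hc₂'g : c₂' ∈ gr M := hGg (hTG (Finset.mem_sdiff.1 (Finset.mem_sdiff.1 hc₂'T).1).1)
    have hc₃'g : c₃' ∈ gr M := hGg (hTG (Finset.mem_sdiff.1 (Finset.mem_sdiff.1 hc₃'T).1).1)
    -- `y₃ ∉ R'`
    have hy₃R' : y₃ ∉ R' := fun h => not_mem_side_of_dist_two_line_deg hs hVg hR₁V hR₁2 hR₁3 hc₂V hc₃V hc₂ hc₃
      hcover hnd₂ hR'V hR'2 hR'3 hc₂'g hc₃'g hc₂' hc₃' hcover' h hy₃3 hy₃L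
    obtain ⟨hY1, hR'Q2⟩ := card_sdiff_line_le_one_of_dist_two hG hd hk hB hnP hz hT hxT hxQ hR' hR'2 hR'c
    have hlev := card_sdiff_coloops_eq_level_add_five hG hd hk hB hnP hz hT
    have hxTQ : x ∈ T \ insert z B := Finset.mem_sdiff.2 ⟨hxT, hxQ⟩
    have hY : ((T \ insert z B).erase x).card + 1 = (T \ insert z B).card := by
      rw [Finset.card_erase_of_mem hxTQ]
      have : 0 < (T \ insert z B).card := Finset.card_pos.2 ⟨x, hxTQ⟩
      omega
    have hR'split : R' ⊆ (R' ∩ insert z B) ∪ (((T \ insert z B).erase x) ∩ R') := by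
      intro r hr
      rw [Finset.mem_union, Finset.mem_inter, Finset.mem_inter]
      by_cases hrQ : r ∈ insert z B
      · exact Or.inl ⟨hr, hrQ⟩
      · refine Or.inr ⟨Finset.mem_erase.2 ⟨?_, Finset.mem_sdiff.2
          ⟨(Finset.mem_sdiff.1 (Finset.mem_sdiff.1 (hR' hr)).1).1, hrQ⟩⟩, hr⟩
        intro h'
        exact (Finset.mem_sdiff.1 (hR' hr)).2 (h' ▸ Finset.mem_insert_of_mem (Finset.mem_singleton_self _))
    have hYR' : (((T \ insert z B).erase x) ∩ R').card + (((T \ insert z B).erase x) \ R').card =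
        ((T \ insert z B).erase x).card := Finset.card_inter_add_card_sdiff _ _
    have hy₃' : y₃ ∈ ((T \ insert z B).erase x) \ R' := Finset.mem_sdiff.2 ⟨hy₃, hy₃R'⟩
    have hpos : 0 < (((T \ insert z B).erase x) \ R').card := Finset.card_pos.2 ⟨y₃, hy₃'⟩
    have hcard := Finset.card_le_card hR'split
    have hcu := Finset.card_union_le (R' ∩ insert z B) (((T \ insert z B).erase x) ∩ R')
    obtain ⟨a, ha, b, hb, hab⟩ := Finset.one_lt_card.1 (by omega : 1 < (R' ∩ insert z B).card)
    have haR : a ∈ R' := (Finset.mem_inter.1 ha).1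
    have hbR : b ∈ R' := (Finset.mem_inter.1 hb).1
    have habg : ({a, b} : Finset α) ⊆ gr M :=
      Finset.insert_subset (hR'g haR) (Finset.singleton_subset_iff.2 (hR'g hbR))
    have hRab : R' ⊆ clF M {a, b} :=
      subset_clF_of_rkN_le_two_of_two_mem hs hR'g hR'2.le haR hbR hab
        (subset_clF_of_subset_gr habg (Finset.mem_insert_self _ _))
        (subset_clF_of_subset_gr habg (Finset.mem_insert_of_mem (Finset.mem_singleton_self _)))
    have hcls : rkN M (insert w₀ (insert x {a, b})) ≤ 3 := by
      have : insert w₀ (insert x {a, b}) ⊆ insert w₀ (insert x R') :=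
        Finset.insert_subset_insert _ (Finset.insert_subset_insert _
          (Finset.insert_subset haR (Finset.singleton_subset_iff.2 hbR)))
      exact (rkN_mono this).trans hR'cls
    -- `Y ∖ {y₃} ⊆ R'`
    have hYsub : ((T \ insert z B).erase x).erase y₃ ⊆ R' := by
      intro e he
      have heY : e ∈ (T \ insert z B).erase x := Finset.mem_of_mem_erase he
      have hey : e ≠ y₃ := (Finset.mem_erase.1 he).1
      by_contra heR
      have hsub : ({e, y₃} : Finset α) ⊆ ((T \ insert z B).erase x) \ R' := by
        intro u hu
        rw [Finset.mem_insert, Finset.mem_singleton] at hu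
        rcases hu with rfl | rfl
        · exact Finset.mem_sdiff.2 ⟨heY, heR⟩
        · exact hy₃'
      have := Finset.card_le_card hsub
      rw [Finset.card_pair hey] at this
      omega
    -- coplanar with `M`
    have hcop : rkN M ({a, b} ∪ Mset) ≤ 3 := by
      by_cases hRL : R' ⊆ clF M R₁
      · -- the spine: `{a, b} ∪ M ⊆ π₃`
        have hπ₃g : insert c₃ R₁ ⊆ gr M := Finset.insert_subset hc₃g hR₁g
        have hsub : ({a, b} : Finset α) ∪ Mset ⊆ clF M (insert c₃ R₁) := by
          intro e he
          rw [Finset.mem_union] at he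
          rcases he with he | he
          · exact clF_mono (Finset.subset_insert _ _) (hRL (by
              rw [Finset.mem_insert, Finset.mem_singleton] at he
              rcases he with rfl | rfl
              · exact haR
              · exact hbR))
          · exact (Finset.mem_filter.1 he).2.1
        have := rkN_mono (M := M) hsub
        rw [rkN_clF, rkN_insert_of_notMem_clF hc₃g (fun h => hc₃ (clF_mono (Finset.subset_insert _ _) h)),
          hR₁2] at this
        exact this
      · -- off the spine: `R' ⊆ π₂` and `source_planes_of_line_off_spine`
        obtain ⟨r, hrR, hrL⟩ : ∃ r ∈ R', r ∉ clF M R₁ := by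
          by_contra h
          push Not at h
          exact hRL h
        have hRπ₂ : R' ⊆ clF M (insert c₂ R₁) := by
          rcases subset_plane_of_rkN_le_two_of_cover hs hR'g hR'2.le hR'3 hR'cover with h' | h'
          · exact h'
          · exfalso
            exact not_mem_side_of_dist_two_line_deg hs hVg hR₁V hR₁2 hR₁3 hc₂V hc₃V hc₂ hc₃ hcover hnd₂
              hR'V hR'2 hR'3 hc₂'g hc₃'g hc₂' hc₃' hcover' hrR (h' hrR) hrL
        have hMS : ∀ e ∈ Mset, e ∉ clF M (insert c₂ R₁) := by
          intro e he h'
          have he' := (Finset.mem_filter.1 he).2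
          exact he'.2 (mem_clF_of_mem_two_planes hR₁g hc₂g hc₃g hc₂ hc₃ h' he'.1)
        have hRM := source_planes_of_line_off_spine hs hR₁g hR₁2 hR₁3 hc₂g hc₂ hR'g hR'2 hRπ₂ hrR hrL
          hc₂'g hc₃'g hc₂' hc₃' hMS (fun e he => hcover' e (Finset.mem_filter.1 he).1)
          (fun e he => hcover' e (hR₁V he))
        have : ({a, b} : Finset α) ∪ Mset ⊆ R' ∪ Mset :=
          Finset.union_subset_union (Finset.insert_subset haR (Finset.singleton_subset_iff.2 hbR))
            (Finset.Subset.refl _)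
        exact (rkN_mono this).trans hRM
    refine ⟨a, hRP₀ R' hR' a haR (Finset.mem_inter.1 ha).2, b, hRP₀ R' hR' b hbR (Finset.mem_inter.1 hb).2,
      hab, hcls, hcop, hYsub.trans hRab, ?_⟩
    intro e he ⟨he3, heL⟩
    exact not_mem_side_of_dist_two_line_deg hs hVg hR₁V hR₁2 hR₁3 hc₂V hc₃V hc₂ hc₃ hcover hnd₂ hR'V hR'2 hR'3
      hc₂'g hc₃'g hc₂' hc₃' hcover' (hYsub he) he3 heL

end PercRepro.Shadow
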